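import Mathlib
import Literature.AlgebraicGeometry.Tropical.TorusCycles
import Summits.HodgeConjecture.HodgeConjecture.Theorems.TropicalWeilObstructionTropicalWeilVanishingGenericSection
import HarnessLib

/-!
# Crux `TropicalWeilVanishing` (stmt-HodgeConjecture-18478), line `identity_transfer` — GENERIC
# SPREAD: the combinatorial type of an effective tropical cycle over a Weil-generic period realises,
# continuously, over every symmetric `J`-commuting period matrix (for `stub_transportToIdentity`)

Route `TropicalWeilObstruction` of `HodgeConjecture`. Fix an effective tropical `n`-cycle `Z` on
`ℝ²ⁿ / Q ℤ²ⁿ` (certificate format `TropicalTorusCycle (2n) n Q`, Mikhalkin–Zharkov Def. 4.2) over a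
symmetric `J`-commuting period `Q` whose free coordinates are algebraically independent
(`IsWeilGeneric`). Freezing the discrete data of `Z` (frames, classes, re-orderings, shifts), its
real data `u = (vertices, edge matrices, reference facets)` solve a linear system `Φ u = Ψ(P)` at
`P = Q`, where `Φ` has integer coefficients and `Ψ(P)_{σ,i,j,a} = Σ_b P_{ab} k_{σ,i,b}`. By
`exists_linear_section` + `weilGeneric_linear_forms` (file `…GenericSection`) one real-linear `G`
solves it for EVERY symmetric `J`-commuting `P`; `u(P) = G Ψ(P) + (u_Z - G Ψ(Q))` is then an affine
(hence continuous) family of solutions through `u(Q) = u_Z` (`genericSpread`). Positivity of the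
edge determinants and non-vanishing of the Weil functional, being open conditions, are left to the
consumer. [Zharkov 2020, p. 3: "the vertices of the cycles vary rationally over the space of
parameters".]

Mathlib + `…GenericSection`; no definition, no named fact, no sorry.

## References

* [Zharkov2020TropicalWeil] I. Zharkov, Tropical abelian varieties, Weil classes and the Hodge
  conjecture, arXiv:2002.02347 (2020), §2 (pp. 2–4).
* [MikhalkinZharkov2014Eigenwave] G. Mikhalkin, I. Zharkov, Tropical eigenwave and intermediate
  Jacobians, LN UMI 15 (2014), Def. 4.2.
-/

-- `Summit.HodgeConjecture.HodgeConjecture.…` is the mandated namespace (single-conjunct summit).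
set_option linter.dupNamespace false

noncomputable section

open scoped BigOperators Matrix
open Matrix Literature.AlgebraicGeometry.Tropical

namespace Summit.HodgeConjecture.HodgeConjecture.Theorems.TropicalWeilVanishing

/-- **Generic spread.** For an effective tropical `n`-cycle `Z` over a positive definite
`J`-commuting Weil-generic period `Q`, there are families `V(P)` (vertices), `T(P)` (edge matrices,
continuous in `P`, `T(Q) =` those of `Z`) and `Rf(P)` (reference facets) which, for EVERY symmetric
`J`-commuting `P`, satisfy the edge equations `V_{σ,j+1} - V_{σ,0} = L_σ T_σ e_j` and the facet
identifications `V_{σ, i.succAbove (π_{σ,i} j)} = Rf_{cls σ i, j} + P k_{σ,i}` of the combinatorial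
type of `Z`. [cite: Zharkov2020TropicalWeil, §2 (p. 3)] [cite: MikhalkinZharkov2014Eigenwave, Def. 4.2] -/
theorem genericSpread {n : ℕ} {Q : Matrix (Fin (2 * n)) (Fin (2 * n)) ℝ} (hQ : Q.PosDef)
    (hQJ : Q * weilJ n = weilJ n * Q) (hgen : IsWeilGeneric n Q) (Z : TropicalTorusCycle (2 * n) n Q) :
    ∃ (V : Matrix (Fin (2 * n)) (Fin (2 * n)) ℝ → Fin Z.numCells → Fin (n + 1) → Fin (2 * n) → ℝ)
      (T : Matrix (Fin (2 * n)) (Fin (2 * n)) ℝ → Fin Z.numCells → Matrix (Fin n) (Fin n) ℝ)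
      (Rf : Matrix (Fin (2 * n)) (Fin (2 * n)) ℝ → Fin Z.numFacetClasses → Fin n → Fin (2 * n) → ℝ),
      (∀ σ, Continuous fun P => T P σ) ∧
      (∀ σ, T Q σ = (Z.cell σ).edgeCoeff) ∧
      ∀ P : Matrix (Fin (2 * n)) (Fin (2 * n)) ℝ, P.IsSymm → P * weilJ n = weilJ n * P →
        (∀ (σ : Fin Z.numCells) (j : Fin n) (a : Fin (2 * n)),
            V P σ j.succ a - V P σ 0 a = ∑ m, ((Z.cell σ).frame a m : ℝ) * T P σ m j) ∧
        (∀ (σ : Fin Z.numCells) (i : Fin (n + 1)) (j : Fin n) (a : Fin (2 * n)),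
            V P σ (i.succAbove (Z.facetPerm σ i j)) a =
              Rf P (Z.facetClass σ i) j a + ∑ b, P a b * (Z.facetShift σ i b : ℝ)) := by
  classical
  -- index types: unknowns `κ` (vertices ⊕ reference facets ⊕ edge matrices), equations `μ`
  -- (edge equations ⊕ facet identifications), parameters `ι` (matrix entries)
  let κ : Type := (Fin Z.numCells × Fin (n + 1) × Fin (2 * n)) ⊕
    ((Fin Z.numFacetClasses × Fin n × Fin (2 * n)) ⊕ (Fin Z.numCells × Fin n × Fin n))
  let μ : Type := (Fin Z.numCells × Fin n × Fin (2 * n)) ⊕ (Fin Z.numCells × Fin (n + 1) × Fin n × Fin (2 * n))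
  let ι : Type := Fin (2 * n) × Fin (2 * n)
  let pκ : κ → (κ → ℝ) →ₗ[ℝ] ℝ := fun k => LinearMap.proj (R := ℝ) (φ := fun _ : κ => ℝ) k
  let pι : ι → (ι → ℝ) →ₗ[ℝ] ℝ := fun i => LinearMap.proj (R := ℝ) (φ := fun _ : ι => ℝ) i
  -- the linear system `Φ u = Ψ t` of the combinatorial type of `Z`
  let Φ : (κ → ℝ) →ₗ[ℝ] (μ → ℝ) :=
    LinearMap.pi fun m : μ => match m with
      | Sum.inl ⟨σ, j, a⟩ =>
          pκ (Sum.inl (σ, j.succ, a)) - pκ (Sum.inl (σ, 0, a)) -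
            ∑ m', ((Z.cell σ).frame a m' : ℝ) • pκ (Sum.inr (Sum.inr (σ, m', j)))
      | Sum.inr ⟨σ, i, j, a⟩ =>
          pκ (Sum.inl (σ, i.succAbove (Z.facetPerm σ i j), a)) -
            pκ (Sum.inr (Sum.inl (Z.facetClass σ i, j, a)))
  let Ψ : (ι → ℝ) →ₗ[ℝ] (μ → ℝ) :=
    LinearMap.pi fun m : μ => match m with
      | Sum.inl _ => 0
      | Sum.inr ⟨σ, i, _, a⟩ => ∑ b, (Z.facetShift σ i b : ℝ) • pι (a, b)
  have Φ_inl : ∀ (u : κ → ℝ) σ j a, Φ u (Sum.inl (σ, j, a)) =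
      u (Sum.inl (σ, j.succ, a)) - u (Sum.inl (σ, 0, a)) -
        ∑ m', ((Z.cell σ).frame a m' : ℝ) * u (Sum.inr (Sum.inr (σ, m', j))) := by
    intro u σ j a
    simp [Φ, pκ, LinearMap.pi_apply, Finset.sum_apply]
  have Φ_inr : ∀ (u : κ → ℝ) σ i j a, Φ u (Sum.inr (σ, i, j, a)) =
      u (Sum.inl (σ, i.succAbove (Z.facetPerm σ i j), a)) -
        u (Sum.inr (Sum.inl (Z.facetClass σ i, j, a))) := by
    intro u σ i j a
    simp [Φ, pκ, LinearMap.pi_apply]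
  have Ψ_inl : ∀ (t : ι → ℝ) x, Ψ t (Sum.inl x) = 0 := by
    intro t x
    simp [Ψ, LinearMap.pi_apply]
  have Ψ_inr : ∀ (t : ι → ℝ) σ i j a, Ψ t (Sum.inr (σ, i, j, a)) =
      ∑ b, (Z.facetShift σ i b : ℝ) * t (a, b) := by
    intro t σ i j a
    simp [Ψ, pι, LinearMap.pi_apply, Finset.sum_apply]
  -- `Φ`, `Ψ` take rational vectors to rational vectors (integer coefficients)
  have hΦ : ∀ u : κ → ℚ, ∃ y : μ → ℚ, Φ (fun k => (u k : ℝ)) = fun m => (y m : ℝ) := by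
    intro u
    refine ⟨fun m => match m with
      | Sum.inl ⟨σ, j, a⟩ => u (Sum.inl (σ, j.succ, a)) - u (Sum.inl (σ, 0, a)) -
          ∑ m', ((Z.cell σ).frame a m' : ℚ) * u (Sum.inr (Sum.inr (σ, m', j)))
      | Sum.inr ⟨σ, i, j, a⟩ => u (Sum.inl (σ, i.succAbove (Z.facetPerm σ i j), a)) -
          u (Sum.inr (Sum.inl (Z.facetClass σ i, j, a))), ?_⟩
    funext m
    rcases m with ⟨σ, j, a⟩ | ⟨σ, i, j, a⟩
    · rw [Φ_inl]; push_cast; rfl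
    · rw [Φ_inr]; push_cast; rfl
  have hΨ : ∀ s : ι → ℚ, ∃ y : μ → ℚ, Ψ (fun i => (s i : ℝ)) = fun m => (y m : ℝ) := by
    intro s
    refine ⟨fun m => match m with
      | Sum.inl _ => 0
      | Sum.inr ⟨σ, i, _, a⟩ => ∑ b, (Z.facetShift σ i b : ℚ) * s (a, b), ?_⟩
    funext m
    rcases m with x | ⟨σ, i, j, a⟩
    · rw [Ψ_inl]; push_cast; rfl
    · rw [Ψ_inr]; push_cast; rfl
  -- genericity of `Q` along the Weil period domain
  let S : Set (ι → ℝ) := {t | ∃ P : Matrix (Fin (2 * n)) (Fin (2 * n)) ℝ,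
    P.IsSymm ∧ P * weilJ n = weilJ n * P ∧ t = fun ab => P ab.1 ab.2}
  let t₀ : ι → ℝ := fun ab => Q ab.1 ab.2
  have hQS : Q.IsSymm := by
    have h := hQ.1
    rw [Matrix.IsHermitian, Matrix.conjTranspose_eq_transpose_of_trivial] at h
    exact h
  have hgenS : ∀ r : ι → ℚ, ∑ i, (r i : ℝ) * t₀ i = 0 → ∀ t ∈ S, ∑ i, (r i : ℝ) * t i = 0 := by
    rintro r hr t ⟨P, hPS, hPJ, rfl⟩
    exact weilGeneric_linear_forms hQ hQJ hgen r hr P hPS hPJ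
  -- the data of `Z` solve the system at `Q`
  let u₀ : κ → ℝ := fun k => match k with
    | Sum.inl ⟨σ, j, a⟩ => (Z.cell σ).vertex j a
    | Sum.inr (Sum.inl ⟨f, j, a⟩) => Z.refFacet f j a
    | Sum.inr (Sum.inr ⟨σ, m, j⟩) => (Z.cell σ).edgeCoeff m j
  have hu₀ : Φ u₀ = Ψ t₀ := by
    funext m
    rcases m with ⟨σ, j, a⟩ | ⟨σ, i, j, a⟩
    · rw [Φ_inl, Ψ_inl]
      simp only [u₀]
      rw [(Z.cell σ).vertex_succ_sub j a, sub_self]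
    · rw [Φ_inr, Ψ_inr]
      simp only [u₀, t₀]
      rw [Z.facet_eq σ i j a, add_sub_cancel_left]
      exact Finset.sum_congr rfl fun b _ => mul_comm _ _
  obtain ⟨G, hG⟩ := exists_linear_section Φ Ψ hΦ hΨ t₀ S hgenS u₀ hu₀
  -- the affine family of solutions through `u₀`
  let tP : Matrix (Fin (2 * n)) (Fin (2 * n)) ℝ → (ι → ℝ) := fun P ab => P ab.1 ab.2
  let uP : Matrix (Fin (2 * n)) (Fin (2 * n)) ℝ → (κ → ℝ) := fun P => G (Ψ (tP P)) + (u₀ - G (Ψ t₀))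
  refine ⟨fun P σ j a => uP P (Sum.inl (σ, j, a)),
    fun P σ => Matrix.of fun m j => uP P (Sum.inr (Sum.inr (σ, m, j))),
    fun P f j a => uP P (Sum.inr (Sum.inl (f, j, a))), ?_, ?_, ?_⟩
  · -- continuity of the edge matrices
    intro σ
    have h1 : Continuous tP :=
      continuous_pi fun ab : ι => (continuous_apply ab.2).comp (continuous_apply ab.1)
    have hcont : Continuous uP :=
      (G.continuous_of_finiteDimensional.comp (Ψ.continuous_of_finiteDimensional.comp h1)).add
        continuous_const
    exact continuous_matrix fun m j =>
      (continuous_apply (Sum.inr (Sum.inr (σ, m, j)))).comp hcont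
  · -- at `Q` the family passes through the data of `Z`
    intro σ
    ext m j
    have : uP Q = u₀ := by
      show G (Ψ t₀) + (u₀ - G (Ψ t₀)) = u₀
      abel
    simp only [Matrix.of_apply, this, u₀]
  · intro P hPS hPJ
    have hsol : Φ (uP P) = Ψ (tP P) := by
      have h := hG (tP P) ⟨P, hPS, hPJ, rfl⟩
      have h0 := hG t₀ ⟨Q, hQS, hQJ, rfl⟩
      show Φ (G (Ψ (tP P)) + (u₀ - G (Ψ t₀))) = Ψ (tP P)
      rw [map_add, map_sub, h, hu₀, h0, sub_self, add_zero]
    constructor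
    · intro σ j a
      have e := congrFun hsol (Sum.inl (σ, j, a))
      rw [Φ_inl, Ψ_inl] at e
      show uP P (Sum.inl (σ, j.succ, a)) - uP P (Sum.inl (σ, 0, a)) =
        ∑ m, ((Z.cell σ).frame a m : ℝ) * (Matrix.of fun m j => uP P (Sum.inr (Sum.inr (σ, m, j)))) m j
      simp only [Matrix.of_apply]
      linarith
    · intro σ i j a
      have e := congrFun hsol (Sum.inr (σ, i, j, a))
      rw [Φ_inr, Ψ_inr, sub_eq_iff_eq_add'] at e
      show uP P (Sum.inl (σ, i.succAbove (Z.facetPerm σ i j), a)) =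
        uP P (Sum.inr (Sum.inl (Z.facetClass σ i, j, a))) + ∑ b, P a b * (Z.facetShift σ i b : ℝ)
      rw [e]
      congr 1
      exact Finset.sum_congr rfl fun b _ => mul_comm _ _

end Summit.HodgeConjecture.HodgeConjecture.Theorems.TropicalWeilVanishing

end
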